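import Mathlib
import HarnessLib
import Literature.Analysis.FluidPDE.VectorCalculus
import Summits.NavierStokesRegularity.NavierStokesRegularity.Theorems.UnthreadedRigidityDoorUnthreadedRigidityVirialHornZonal
import Summits.NavierStokesRegularity.NavierStokesRegularity.Theorems.UnthreadedRigidityDoorUnthreadedRigidityPolyhedralIsotropicField
import Summits.NavierStokesRegularity.NavierStokesRegularity.Theorems.UnthreadedRigidityDoorUnthreadedRigidityPersistenceGradSqAffineZonal
import Summits.NavierStokesRegularity.NavierStokesRegularity.Theorems.UnthreadedRigidityDoorUnthreadedRigidityPersistenceGradSqAffineMeridian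
import Literature.Analysis.FluidPDE.AxisymmetricReflection

/-!
# Route `UnthreadedRigidityDoor`, wall item W2 `UnthreadedRigidity` (stmt-NavierStokesRegularity-27585) — LINE g12-2 «PERSISTENCE FILTER»
# (ns-idea-6 g12, `Persistence_sketch.lean` 09bc8f71301208c4; idea-crit-7 PASS; DIRECTOR-NS #294): support S–M «AFFINE GRADIENT LAW»
# `GradSqAffineLaw`, VERBATIM

Seat ns-es-p1 g8 (W2 second queue).  Typed sub-split T3 of 3 (T1 `…PersistenceGradSqAffineZonal`, T2 `…PersistenceGradSqAffineMeridian`).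

* (a point of the unit circle is `(cos θ, sin θ)` = the tree's `Literature.Analysis.FluidPDE.exists_cos_eq_sin_eq`.)
* `gradSqAffineLaw` — **`GradSqAffineLaw` VERBATIM**: a nonzero solid harmonic of degree `l ≥ 2` with `|∇Y|² = aY + c` on `S²` has `l = 2` and is
  zonal.  PROOF.  Zonal: T1 (`isZonal_of_affine`, via S-C `angularLemma_holds`).  `l = 2`: normalise the axis `a`, pick a unit `b ⊥ a` with the
  meridian `γ(θ) = cos θ·a + sin θ·b` through `y₁/|y₁|`, `Y(y₁) ≠ 0` (`b ⊥ a`, `b ⊥ a × y₁`: `…Polyhedral.exists_perp_perp`); along it (T2)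
  `f = Y ∘ γ` obeys the sphere law `f′² + l²f² = a f + c` and the Legendre relation `sin θ f″ + cos θ f′ + l(l+1) sin θ f = 0`.  Differentiating the
  sphere law, `f′(2f″ + 2l²f − a) = 0`.  If `f′ ≡ 0` then `f ≡ f(θ₁) ≠ 0`, `f″ ≡ 0`, and Legendre at `π/2` gives `l(l+1)f = 0`, absurd.  Otherwise on
  the open set `U = {f′ ≠ 0}`: `2f″ = a − 2l²f`, so (Legendre) `2cos θ f′ = −sin θ(a + 2lf)`; differentiating this on `U`,
  `(l−1) sin θ f′ = cos θ(l(l−1)f − a)`; eliminating `f′`, `2l(l−1)f = 2a cos²θ − (l−1)a sin²θ` on `U`; differentiating once more at `θ₀ ∈ U`,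
  `l(l−1)f′(θ₀) = −a(l+1) sin θ₀ cos θ₀ ≠ 0`, and substituting back into the first relation `a(l+1)(l−2) sin θ₀ cos²θ₀ = 0`, i.e. `l = 2`.
  (No Legendre polynomials are needed; this replaces the CARD's coefficient count.)

HONEST LABEL: calculus about special separable data (support of a files-only rung line); nothing here bears on `UnthreadedRigidity` (27585), the door
Target, W2 or Navier–Stokes regularity; no summit statement is proved.  MODEL/rung work.
-/

noncomputable section

-- the summit and its single sub-problem share the name (CONVENTIONS §1), as in every Theorems file
set_option linter.dupNamespace false

namespace Summit.NavierStokesRegularity.NavierStokesRegularity.Theorems.UnthreadedRigidity.Persistence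

open scoped InnerProductSpace Topology
open Set Filter
open Literature.Analysis.FluidPDE (cross exists_cos_eq_sin_eq)
open Summit.NavierStokesRegularity.NavierStokesRegularity.Theorems.UnthreadedRigidity.ProfileHorn (E3)
open Summit.NavierStokesRegularity.NavierStokesRegularity.Theorems.UnthreadedRigidity.VirialHorn
  (det3 IsSolidHarmonic IsZonalAbout IsZonal det3_eq_inner_cross_left det3_smul_left)
open Summit.NavierStokesRegularity.NavierStokesRegularity.Theorems.UnthreadedRigidity.Polyhedral (exists_perp_perp)

-- (a point of the unit circle is `(cos θ, sin θ)`: the tree's `Literature.Analysis.FluidPDE.exists_cos_eq_sin_eq`.)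

/-- **`GradSqAffineLaw` (VERBATIM)**: a nonzero solid harmonic of degree `l ≥ 2` whose `|∇Y|²` is affine in `Y` on the unit sphere is quadratic
(`l = 2`) and zonal (module docstring for the proof). -/
theorem gradSqAffineLaw :
    ∀ (l : ℕ) (Y : E3 → ℝ), 2 ≤ l → IsSolidHarmonic l Y → (∃ y, Y y ≠ 0) →
      (∃ a c : ℝ, ∀ y : E3, ‖y‖ = 1 → ‖gradient Y y‖ ^ 2 = a * Y y + c) → l = 2 ∧ IsZonal Y := by
  intro l Y hl hY hne haff
  obtain ⟨a₀, c₀, haff⟩ := haff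
  have hzonal : IsZonal Y := isZonal_of_affine hl hY haff
  refine ⟨?_, hzonal⟩
  have hl2 : (2 : ℝ) ≤ (l : ℝ) := by exact_mod_cast hl
  -- a unit axis
  obtain ⟨a₁, ha₁, hZ₁⟩ := hzonal
  have ha₁n : ‖a₁‖ ≠ 0 := norm_ne_zero_iff.2 ha₁
  set a : E3 := (‖a₁‖⁻¹ : ℝ) • a₁ with ha_def
  have ha : ‖a‖ = 1 := by rw [ha_def, norm_smul, norm_inv, norm_norm, inv_mul_cancel₀ ha₁n]
  have hZ : IsZonalAbout a Y := fun y => by rw [ha_def, det3_smul_left, hZ₁ y, mul_zero]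
  -- a unit `b ⊥ a` with the meridian through `y₁`
  obtain ⟨y₁, hy₁⟩ := hne
  have hy₁0 : y₁ ≠ 0 := by
    rintro rfl
    have h := hY.apply_smul 0 (0 : E3)
    rw [zero_smul, zero_pow (by omega), zero_mul] at h
    exact hy₁ h
  obtain ⟨w, hw0, hwy, hwa⟩ := exists_perp_perp (cross a y₁) a
  have hwn : ‖w‖ ≠ 0 := norm_ne_zero_iff.2 hw0
  set b : E3 := (‖w‖⁻¹ : ℝ) • w with hb_def
  have hb : ‖b‖ = 1 := by rw [hb_def, norm_smul, norm_inv, norm_norm, inv_mul_cancel₀ hwn]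
  have hab : ⟪a, b⟫_ℝ = 0 := by rw [hb_def, real_inner_smul_right, hwa, mul_zero]
  have hcy : ⟪cross a b, y₁⟫_ℝ = 0 := by
    have h1 : ⟪cross a b, y₁⟫_ℝ = -⟪cross a y₁, b⟫_ℝ := by
      rw [← det3_eq_inner_cross_left, ← det3_eq_inner_cross_left]; unfold det3; ring
    rw [h1, hb_def, real_inner_smul_right, hwy, mul_zero, neg_zero]
  obtain ⟨B, hB0, hB1, hB2⟩ := exists_orthonormalBasis ha hb hab
  have hy₁rep : y₁ = ⟪a, y₁⟫_ℝ • a + ⟪b, y₁⟫_ℝ • b := by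
    have h := B.sum_repr' y₁
    rw [Fin.sum_univ_three, hB0, hB1, hB2, hcy, zero_smul, add_zero] at h
    exact h.symm
  set ρ : ℝ := ‖y₁‖ with hρ_def
  have hρ : 0 < ρ := norm_pos_iff.2 hy₁0
  have hsq : (⟪a, y₁⟫_ℝ / ρ) ^ 2 + (⟪b, y₁⟫_ℝ / ρ) ^ 2 = 1 := by
    have h := parseval_frame ha hb hab y₁
    rw [hcy] at h
    field_simp
    nlinarith [h]
  obtain ⟨θ₁, hcos, hsin⟩ := exists_cos_eq_sin_eq hsq
  have hγθ₁ : Real.cos θ₁ • a + Real.sin θ₁ • b = (ρ⁻¹ : ℝ) • y₁ := by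
    have h := congrArg (fun v : E3 => (ρ⁻¹ : ℝ) • v) hy₁rep
    simp only [smul_add, smul_smul] at h
    rw [h, hcos, hsin, div_eq_inv_mul, div_eq_inv_mul]
  have hf₁ : Y (Real.cos θ₁ • a + Real.sin θ₁ • b) ≠ 0 := by
    rw [hγθ₁, hY.apply_smul]
    exact mul_ne_zero (pow_ne_zero _ (inv_ne_zero hρ.ne')) hy₁
  -- the meridian functions `f`, `f′`, `f″`
  set f : ℝ → ℝ := fun t => Y (Real.cos t • a + Real.sin t • b) with hf
  set fd : ℝ → ℝ := fun t =>
    ⟪gradient Y (Real.cos t • a + Real.sin t • b), -Real.sin t • a + Real.cos t • b⟫_ℝ with hfd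
  set fdd : ℝ → ℝ := fun t =>
    ⟪fderiv ℝ (gradient Y) (Real.cos t • a + Real.sin t • b) (-Real.sin t • a + Real.cos t • b),
        -Real.sin t • a + Real.cos t • b⟫_ℝ
      - ⟪gradient Y (Real.cos t • a + Real.sin t • b), Real.cos t • a + Real.sin t • b⟫_ℝ with hfdd
  have hfder : ∀ t, HasDerivAt f (fd t) t := fun t => hasDerivAt_meridian hY a b t
  have hfdder : ∀ t, HasDerivAt fd (fdd t) t := fun t => hasDerivAt_meridian_deriv hY a b t
  have hleg : ∀ t, Real.sin t * fdd t + Real.cos t * fd t + (l : ℝ) * ((l : ℝ) + 1) * Real.sin t * f t = 0 :=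
    fun t => meridian_legendre hY hZ ha hb hab t
  have hsph : ∀ t, fd t ^ 2 + (l : ℝ) ^ 2 * f t ^ 2 = a₀ * f t + c₀ := by
    intro t
    have h1 := haff _ (norm_gamma ha hb hab t)
    rw [meridian_normSq hY hZ ha hb hab t] at h1
    exact h1
  -- the sphere law differentiated: `f′(2f″ + 2l²f − a) = 0`
  have hdiff : ∀ t, fd t * (2 * fdd t + 2 * (l : ℝ) ^ 2 * f t - a₀) = 0 := by
    intro t
    have h1 : HasDerivAt (fun s => fd s ^ 2 + (l : ℝ) ^ 2 * f s ^ 2 - a₀ * f s - c₀)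
        (2 * fd t * fdd t + (l : ℝ) ^ 2 * (2 * f t * fd t) - a₀ * fd t) t := by
      have h := ((((hfdder t).fun_pow 2).add (((hfder t).fun_pow 2).const_mul ((l : ℝ) ^ 2))).sub
        ((hfder t).const_mul a₀)).sub_const c₀
      exact h.congr_deriv (by norm_num)
    have h2 : (fun s => fd s ^ 2 + (l : ℝ) ^ 2 * f s ^ 2 - a₀ * f s - c₀) = fun _ => (0 : ℝ) := by
      funext s; rw [hsph s]; ring
    rw [h2] at h1
    have h3 := h1.unique (hasDerivAt_const t (0 : ℝ))
    linear_combination h3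
  have hfd_cont : Continuous fd := continuous_iff_continuousAt.2 fun t => (hfdder t).continuousAt
  by_cases hU : ∀ t, fd t = 0
  · -- `f′ ≡ 0`: `f` is the constant `f(θ₁) ≠ 0`, contradicting the Legendre relation at `π/2`
    exfalso
    have hdf : Differentiable ℝ f := fun t => (hfder t).differentiableAt
    have hconst : ∀ s t, f s = f t := fun s t =>
      is_const_of_deriv_eq_zero hdf (fun t => by rw [(hfder t).deriv, hU t]) s t
    have hfdd0 : fdd (Real.pi / 2) = 0 := by
      have h1 : HasDerivAt fd (fdd (Real.pi / 2)) (Real.pi / 2) := hfdder _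
      have h2 : fd = fun _ => (0 : ℝ) := funext hU
      rw [h2] at h1
      exact h1.unique (hasDerivAt_const _ _)
    have h3 := hleg (Real.pi / 2)
    rw [Real.sin_pi_div_two, Real.cos_pi_div_two, hfdd0] at h3
    have h4 : (l : ℝ) * ((l : ℝ) + 1) * f (Real.pi / 2) = 0 := by linarith
    have h5 : (l : ℝ) * ((l : ℝ) + 1) ≠ 0 := by positivity
    have h6 : f (Real.pi / 2) = 0 := (mul_eq_zero.1 h4).resolve_left h5
    rw [hconst (Real.pi / 2) θ₁] at h6
    exact hf₁ h6
  · push Not at hU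
    obtain ⟨θ₀, hθ₀⟩ := hU
    have hUo : IsOpen {t : ℝ | fd t ≠ 0} := isOpen_ne_fun hfd_cont continuous_const
    -- on `U`: `2f″ = a − 2l²f`, hence `2cos θ f′ = −sin θ (a + 2lf)`
    have hfdd_of : ∀ t, fd t ≠ 0 → 2 * fdd t + 2 * (l : ℝ) ^ 2 * f t - a₀ = 0 := fun t ht =>
      (mul_eq_zero.1 (hdiff t)).resolve_left ht
    have hE1 : ∀ t, fd t ≠ 0 → 2 * Real.cos t * fd t = -Real.sin t * (a₀ + 2 * (l : ℝ) * f t) := by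
      intro t ht
      linear_combination 2 * hleg t - Real.sin t * hfdd_of t ht
    -- differentiate on the open set `U`: `(l−1) sin θ f′ = cos θ (l(l−1)f − a)`
    have hE2 : ∀ t, fd t ≠ 0 →
        ((l : ℝ) - 1) * Real.sin t * fd t = Real.cos t * ((l : ℝ) * ((l : ℝ) - 1) * f t - a₀) := by
      intro t ht
      have hev : (fun s => 2 * Real.cos s * fd s) =ᶠ[𝓝 t] fun s => -Real.sin s * (a₀ + 2 * (l : ℝ) * f s) := by
        filter_upwards [hUo.mem_nhds ht] with s hs using hE1 s hs
      have hL : HasDerivAt (fun s => 2 * Real.cos s * fd s) (2 * -Real.sin t * fd t + 2 * Real.cos t * fdd t) t :=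
        ((Real.hasDerivAt_cos t).const_mul 2).mul (hfdder t)
      have hR : HasDerivAt (fun s => -Real.sin s * (a₀ + 2 * (l : ℝ) * f s))
          (-Real.cos t * (a₀ + 2 * (l : ℝ) * f t) + -Real.sin t * (2 * (l : ℝ) * fd t)) t :=
        (Real.hasDerivAt_sin t).neg.mul (((hfder t).const_mul (2 * (l : ℝ))).const_add a₀)
      have heq := (hL.congr_of_eventuallyEq hev.symm).unique hR
      linear_combination (1 / 2 : ℝ) * heq - (1 / 2 : ℝ) * Real.cos t * hfdd_of t ht
    -- eliminate `f′`: `2l(l−1)f = 2a cos² − (l−1)a sin²` on `U`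
    have hF : ∀ t, fd t ≠ 0 →
        2 * (l : ℝ) * ((l : ℝ) - 1) * f t = 2 * a₀ * Real.cos t ^ 2 - ((l : ℝ) - 1) * a₀ * Real.sin t ^ 2 := by
      intro t ht
      linear_combination (-2 * Real.cos t) * hE2 t ht + ((l : ℝ) - 1) * Real.sin t * hE1 t ht
        - 2 * (l : ℝ) * ((l : ℝ) - 1) * f t * Real.sin_sq_add_cos_sq t
    -- differentiate once more at `θ₀`
    have hD : 2 * (l : ℝ) * ((l : ℝ) - 1) * fd θ₀ = -2 * a₀ * ((l : ℝ) + 1) * Real.sin θ₀ * Real.cos θ₀ := by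
      have hev : (fun s => 2 * (l : ℝ) * ((l : ℝ) - 1) * f s)
          =ᶠ[𝓝 θ₀] fun s => 2 * a₀ * Real.cos s ^ 2 - ((l : ℝ) - 1) * a₀ * Real.sin s ^ 2 := by
        filter_upwards [hUo.mem_nhds hθ₀] with s hs using hF s hs
      have hL : HasDerivAt (fun s => 2 * (l : ℝ) * ((l : ℝ) - 1) * f s) (2 * (l : ℝ) * ((l : ℝ) - 1) * fd θ₀) θ₀ :=
        (hfder θ₀).const_mul _
      have hR : HasDerivAt (fun s => 2 * a₀ * Real.cos s ^ 2 - ((l : ℝ) - 1) * a₀ * Real.sin s ^ 2)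
          (2 * a₀ * (2 * Real.cos θ₀ * -Real.sin θ₀) - ((l : ℝ) - 1) * a₀ * (2 * Real.sin θ₀ * Real.cos θ₀)) θ₀ := by
        have h1 := ((Real.hasDerivAt_cos θ₀).fun_pow 2).const_mul (2 * a₀)
        have h2 := ((Real.hasDerivAt_sin θ₀).fun_pow 2).const_mul (((l : ℝ) - 1) * a₀)
        exact (h1.sub h2).congr_deriv (by norm_num)
      have heq := (hL.congr_of_eventuallyEq hev.symm).unique hR
      linear_combination heq
    -- every factor of `l(l−1) f′(θ₀) = −a(l+1) sin θ₀ cos θ₀` is nonzero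
    have hcoef : 2 * (l : ℝ) * ((l : ℝ) - 1) ≠ 0 :=
      mul_ne_zero (mul_ne_zero two_ne_zero (by linarith)) (by linarith)
    have hprod : a₀ * ((l : ℝ) + 1) * Real.sin θ₀ * Real.cos θ₀ ≠ 0 := by
      intro h0
      have h1 : 2 * (l : ℝ) * ((l : ℝ) - 1) * fd θ₀ = 0 := by rw [hD]; linear_combination -2 * h0
      exact hθ₀ ((mul_eq_zero.1 h1).resolve_left hcoef)
    have hcos0 : Real.cos θ₀ ≠ 0 := fun h => hprod (by rw [h, mul_zero])
    -- substitute back into the first relation: `a(l+1)(l−2) sin θ₀ cos² θ₀ = 0`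
    have hfin : a₀ * ((l : ℝ) + 1) * Real.sin θ₀ * Real.cos θ₀ * Real.cos θ₀ * ((l : ℝ) - 2) = 0 := by
      linear_combination (-Real.cos θ₀) * hD + (l : ℝ) * ((l : ℝ) - 1) * hE1 θ₀ hθ₀
        - (l : ℝ) * Real.sin θ₀ * hF θ₀ hθ₀ + a₀ * (l : ℝ) * ((l : ℝ) - 1) * Real.sin θ₀ * Real.sin_sq_add_cos_sq θ₀
    have hl' : (l : ℝ) - 2 = 0 := (mul_eq_zero.1 hfin).resolve_left (mul_ne_zero hprod hcos0)
    have hl'' : (l : ℝ) = 2 := by linarith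
    exact_mod_cast hl''

end Summit.NavierStokesRegularity.NavierStokesRegularity.Theorems.UnthreadedRigidity.Persistence

end
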